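import Mathlib
import HarnessLib
import Literature.NumberTheory.LFunctions.ZetaZerosReflection
import Summits.RiemannHypothesis.RiemannHypothesis.Theorems.IntegerScrewScrewDetectionDepthOfDiagonal

/-!
# Route `IntegerScrew`, LINE «SCREW DEPTH–HEIGHT DICTIONARY» (rh-idea-10/A) — ζ's SHIFTED ZERO DATUM
# IS SYMMETRIC, and the line glue from the SYMMETRIC-DATUM form `C′` of the crux

The critic's price on the line (idea-crit-2, PASS-WITH-PRICE) names one misstatement risk for the open
crux `ScrewDiagonalDetection` (item `stmt-RiemannHypothesis-21784`): effective diagonal detection for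
ABSTRACT zero data might need the datum to be SYMMETRIC — the repaired statement `C′` would add to the
hypotheses of the crux that `Z` is conjugation invariant, `Z(w̄) = Z(w)`, and even, `Z(−w) = Z(w)` (for
ζ these are `m(ρ̄) = m(ρ)` and the functional-equation symmetry `m(1 − ρ) = m(ρ)` of the multiplicities,
read through the shift `w = ρ − ½`).

This file makes the line target robust to that repair:

* `datum_neg` — ζ's shifted zero datum is EVEN (`riemannZetaZeroOrder_one_sub_holds`,
  `ZetaZeros.riemannZetaNontrivialZeros.one_sub_conj_mem`/`conj_mem`, all PROVED in the tree); with
  `datum_conj`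
  (file `IntegerScrewZetaScrewDatumAdmissible`) this is packaged as `zetaScrewDatumSymmetric`;
* `screwDetectionDepth_of_symmetricDiagonalDetection` — the WEAKER crux `C′` (the signature of item
  21784 with the two symmetry hypotheses inserted) still implies the line target `ScrewDetectionDepth`
  (item `stmt-RiemannHypothesis-21800`, signature verbatim), by the same instantiation as
  `screwDetectionDepth_of_screwDiagonalDetection`;
* `symmetricDiagonalDetection_of_screwDiagonalDetection` — bookkeeping: the crux as filed implies `C′`.

HONEST LABEL.  Neither the crux nor `C′` is proved here (both OPEN); only implications and the
symmetry of ζ's datum are.  RH is NOT proved by this file and nothing here bears on the truth of RH.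
References: E. C. Titchmarsh, *The Theory of the Riemann Zeta-Function* (1986) §2.12 (symmetries of
the zeros); M. Suzuki, *J. Lond. Math. Soc.* (2) 108 (2023), Thm 1.1 [Suzuki2023].
-/

noncomputable section

-- D-0017: `Summit.<S>.<S>.…` is the designed namespace of a single-problem summit.
set_option linter.dupNamespace false

namespace Summit.RiemannHypothesis.RiemannHypothesis.Theorems.IntegerScrew

open Literature.NumberTheory.LFunctions

variable {Z : ℂ → ℕ}

/-- Reflection of the shifted zero set: if `½ + v` is a non-trivial zero then so is
`½ + (−v) = 1 − (½ + v)`, with the same multiplicity (functional equation; Titchmarsh §2.12).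
[folklore] -/
theorem shift_reflect {v : ℂ} (hv : (1 / 2 + v) ∈ ZetaZeros.riemannZetaNontrivialZeros) :
    (1 / 2 + -v) ∈ ZetaZeros.riemannZetaNontrivialZeros ∧
      riemannZetaZeroOrder (1 / 2 + -v) = riemannZetaZeroOrder (1 / 2 + v) := by
  have e : (1 / 2 : ℂ) + -v = 1 - (1 / 2 + v) := by ring
  have hmem : 1 - (1 / 2 + v) ∈ ZetaZeros.riemannZetaNontrivialZeros := by
    have h1 := ZetaZeros.riemannZetaNontrivialZeros.conj_mem
      (ZetaZeros.riemannZetaNontrivialZeros.one_sub_conj_mem hv)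
    simpa using h1
  rw [e]
  exact ⟨hmem, riemannZetaZeroOrder_one_sub_holds (ZetaZeros.riemannZetaNontrivialZeros.re_pos hv)
    (ZetaZeros.riemannZetaNontrivialZeros.re_lt_one hv)⟩

/-- ζ's shifted zero datum is EVEN: `Z(−w) = Z(w)` (`m(1 − ρ) = m(ρ)`). [folklore] -/
theorem datum_neg (hZ : ∀ w : ℂ, Z w = Set.indicator ((fun v : ℂ => 1 / 2 + v) ⁻¹'
      ZetaZeros.riemannZetaNontrivialZeros) (fun v : ℂ => (riemannZetaZeroOrder (1 / 2 + v)).toNat) w)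
    (w : ℂ) : Z (-w) = Z w := by
  by_cases h : (1 / 2 + w) ∈ ZetaZeros.riemannZetaNontrivialZeros
  · obtain ⟨h', horder⟩ := shift_reflect h
    rw [hZ, hZ, Set.indicator_of_mem (show -w ∈ _ from h'), Set.indicator_of_mem (show w ∈ _ from h)]
    simp only [horder]
  · have h' : (1 / 2 + -w) ∉ ZetaZeros.riemannZetaNontrivialZeros := by
      intro h'
      apply h
      have h'' := (shift_reflect h').1
      rw [neg_neg] at h''
      exact h''
    rw [datum_eq_zero hZ h, datum_eq_zero hZ h']

/-- **ζ's shifted zero datum is symmetric**: conjugation invariant (`Z(w̄) = Z(w)`, `datum_conj`) and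
even (`Z(−w) = Z(w)`, `datum_neg`) — the two symmetry hypotheses of the repaired crux `C′`.  From the
PROVED tree facts `riemannZetaZeroOrder_conj_holds` and `riemannZetaZeroOrder_one_sub_holds`.  RH is
not proved by this; nothing here bears on the truth of RH. [folklore] -/
theorem zetaScrewDatumSymmetric : ∀ Z : ℂ → ℕ, (∀ w : ℂ, Z w = Set.indicator ((fun v : ℂ => 1 / 2 + v) ⁻¹' Literature.NumberTheory.LFunctions.ZetaZeros.riemannZetaNontrivialZeros) (fun v : ℂ => (Literature.NumberTheory.LFunctions.riemannZetaZeroOrder (1 / 2 + v)).toNat) w) → (∀ w : ℂ, Z ((starRingEnd ℂ) w) = Z w) ∧ (∀ w : ℂ, Z (-w) = Z w) :=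
  fun _ hZ => ⟨fun w => datum_conj hZ w, fun w => datum_neg hZ w⟩

/-- **Line glue from the symmetric-datum crux `C′`.**  If effective diagonal detection holds for every
SYMMETRIC admissible abstract datum (the signature of item `stmt-RiemannHypothesis-21784` with the
hypotheses `Z(w̄) = Z(w)` and `Z(−w) = Z(w)` inserted — the critic's repair `C′`), then the line target
`ScrewDetectionDepth` (item `stmt-RiemannHypothesis-21800`, verbatim) holds: ζ's shifted datum is
symmetric (`zetaScrewDatumSymmetric`) and admissible (`zetaScrewDatumAdmissible`), and the rest is the
instantiation of `screwDetectionDepth_of_screwDiagonalDetection` (`w₀ = s − ½`, `Ψ(L) < −1`, sampling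
at `m = ⌊e^L⌋`, depth `≤ (11(2+|γ|))^{8/η}`).  `C′` is OPEN; RH is not proved by this and nothing here
bears on the truth of RH. [folklore] -/
theorem screwDetectionDepth_of_symmetricDiagonalDetection
    (hDet : ∀ (Z : ℂ → ℕ) (σ : ℝ), (∀ w : ℂ, Z ((starRingEnd ℂ) w) = Z w) → (∀ w : ℂ, Z (-w) = Z w) → HasSum (fun w : ℂ => (Z w : ℝ) / ‖w‖ ^ 2) σ → (∀ w : ℂ, Z w ≠ 0 → |w.re| < 1 / 2 ∧ 1 ≤ |w.im|) → (∀ T : ℝ, 1 ≤ |T| → ∑' w : ℂ, (if |w.im - T| ≤ 1 then (Z w : ℝ) else 0) ≤ Real.log |T| + 20) → ∀ w₀ : ℂ, Z w₀ ≠ 0 → 0 < w₀.re → ∃ L : ℝ, 20 ≤ L ∧ L ≤ 8 / w₀.re * Real.log ((10 + σ) * (2 + |w₀.im|)) ∧ ∑' w : ℂ, (Z w : ℝ) * ((Complex.cosh (w * L) - 1) / w ^ 2).re < -1) :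
    ∀ s : ℂ, riemannZeta s = 0 → (¬∃ n : ℕ, s = -2 * ((n : ℂ) + 1)) → 1 / 2 < s.re → ∃ m : ℕ, 2 ≤ m ∧ (m : ℝ) ≤ (11 * (2 + |s.im|)) ^ (8 / (s.re - 1 / 2)) ∧ Literature.NumberTheory.LFunctions.zetaScrew (Real.log m) < 0 := by
  intro s hs hnt hre
  -- ζ's shifted zero datum: admissible (item 21806) and symmetric (this file)
  set Z : ℂ → ℕ := Set.indicator ((fun v : ℂ => 1 / 2 + v) ⁻¹' ZetaZeros.riemannZetaNontrivialZeros)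
    (fun v : ℂ => (riemannZetaZeroOrder (1 / 2 + v)).toNat) with hZdef
  have hZ : ∀ w : ℂ, Z w = Set.indicator ((fun v : ℂ => 1 / 2 + v) ⁻¹'
      ZetaZeros.riemannZetaNontrivialZeros) (fun v : ℂ => (riemannZetaZeroOrder (1 / 2 + v)).toNat) w :=
    fun w => rfl
  obtain ⟨⟨σ, hσle, hσ⟩, hsupp, hwin, hser⟩ := zetaScrewDatumAdmissible Z hZ
  obtain ⟨hconj, hev⟩ := zetaScrewDatumSymmetric Z hZ
  have hσ0 : 0 ≤ σ := hσ.nonneg fun w => by positivity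
  -- the off-line point `w₀ = s − ½`
  have hmem : s ∈ ZetaZeros.riemannZetaNontrivialZeros := mem_nontrivialZeros_of_not_trivial hs hnt
  have hw₀ : Z (s - 1 / 2) ≠ 0 := datum_shift_ne_zero hZ hmem
  have hre' : (s - 1 / 2 : ℂ).re = s.re - 1 / 2 := by simp
  have him' : (s - 1 / 2 : ℂ).im = s.im := by simp
  have hη : 0 < (s - 1 / 2 : ℂ).re := by rw [hre']; linarith
  -- `C′` detects: `Ψ_Z(L) < −1` at a depth `20 ≤ L ≤ (8/η) log((10+σ)(2+|γ|))`
  obtain ⟨L, hL20, hLle, hneg⟩ := hDet Z σ hconj hev hσ hsupp hwin (s - 1 / 2) hw₀ hη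
  rw [hre', him'] at hLle
  have hΨL : zetaScrew L < -1 := by rw [hser L]; exact hneg
  -- integer sampling (item 21807)
  obtain ⟨m, hm2, hmle, hmd⟩ := zetaScrewSampling L hL20
  refine ⟨m, hm2, depth_le_rpow hσ0 hσle (by linarith) hLle hmle, ?_⟩
  have h := (abs_le.1 hmd).2
  linarith

/-- Bookkeeping: the crux as filed (item 21784, verbatim) implies its symmetric-datum weakening `C′`
(drop the two symmetry hypotheses). [folklore] -/
theorem symmetricDiagonalDetection_of_screwDiagonalDetection
    (hDet : ∀ (Z : ℂ → ℕ) (σ : ℝ), HasSum (fun w : ℂ => (Z w : ℝ) / ‖w‖ ^ 2) σ → (∀ w : ℂ, Z w ≠ 0 → |w.re| < 1 / 2 ∧ 1 ≤ |w.im|) → (∀ T : ℝ, 1 ≤ |T| → ∑' w : ℂ, (if |w.im - T| ≤ 1 then (Z w : ℝ) else 0) ≤ Real.log |T| + 20) → ∀ w₀ : ℂ, Z w₀ ≠ 0 → 0 < w₀.re → ∃ L : ℝ, 20 ≤ L ∧ L ≤ 8 / w₀.re * Real.log ((10 + σ) * (2 + |w₀.im|)) ∧ ∑' w : ℂ, (Z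 w : ℝ) * ((Complex.cosh (w * L) - 1) / w ^ 2).re < -1) :
    ∀ (Z : ℂ → ℕ) (σ : ℝ), (∀ w : ℂ, Z ((starRingEnd ℂ) w) = Z w) → (∀ w : ℂ, Z (-w) = Z w) → HasSum (fun w : ℂ => (Z w : ℝ) / ‖w‖ ^ 2) σ → (∀ w : ℂ, Z w ≠ 0 → |w.re| < 1 / 2 ∧ 1 ≤ |w.im|) → (∀ T : ℝ, 1 ≤ |T| → ∑' w : ℂ, (if |w.im - T| ≤ 1 then (Z w : ℝ) else 0) ≤ Real.log |T| + 20) → ∀ w₀ : ℂ, Z w₀ ≠ 0 → 0 < w₀.re → ∃ L : ℝ, 20 ≤ L ∧ L ≤ 8 / w₀.re * Real.log ((10 + σ) * (2 + |w₀.im|)) ∧ ∑' w : ℂ, (Z w : ℝ) * ((Complex.cosh (w * L) - 1) / w ^ 2).re < -1 :=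
  fun Z σ _ _ hσ hsupp hwin => hDet Z σ hσ hsupp hwin

end Summit.RiemannHypothesis.RiemannHypothesis.Theorems.IntegerScrew

end
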